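import Summits.ValiantsHypothesis.ValiantsHypothesis.Theorems.LacunarySymmetroidMatrixDescartesDoorA26WallBubblingSignCut

/-!
# `DoorA26` / line `wall_bubbling` — NO BALANCE: balanced rank-one touch profiles do not exist; every honestly encoded rank-one touch
profile lifts to a twenty (the single-cluster RANK-ONE multiplicity residual of (R) is empty)

HONEST FRAMING.  Object-search cell `pub-symmetroid`, crux `Theses.LacunarySymmetroid.DoorA26` (stmt-ValiantsHypothesis-19979; OPEN, typed,
never asserted).  W2 seat val-sym-door-p1 g19, file #55; def-free helper for obligation (R) of `Cruxes/DoorA26/Lines/wall_bubbling.lean`, closing the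
programme of #43–#52 (W2 g16–g18): #47 `mem_twentyLocus_of_touches_noBalance` lifts a rank-one touch profile to a twenty UNLESS it is BALANCED
(`μ ≥ 0` on the touch set, not all zero, `Σ_j μ_j κ_j e^{δ_l τ_j} P(τ_j) = 0` for all six `l`); #48 counted `≥ 7` touches in a balance; the seat memo of
g18 (§9/§10) left «balanced profiles, 7 ≤ |J| ≤ 10» as the open residual.  THIS FILE PROVES THERE ARE NONE.

SETTING (the currency of #46–#48).  Strictly increasing real exponents `δ : Fin 6 → ℝ`, symmetric letters `S_l`, pencil `P(t) = Σ_l e^{δ_l t} S_l`,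
`21` strictly increasing abscissae `τ`, alternating virtual signs `κ` (`κ_j κ_{j+1} < 0`), touch set `J ⊆ Fin 21`: off `J` `0 < κ_j det P(τ_j)`, on `J`
`det P(τ_j) = 0 ≠ tr P(τ_j)` (rank-one touches).  HONEST ENCODING (new hypotheses, free in the application): `0 ∉ J`, `20 ∉ J`, and no two adjacent
indices lie in `J` — exactly how a limit profile with `n` rank-one double zeros and `20 − 2n` simple zeros sits on `21` abscissae (one abscissa in each of
the `21 − n` constant-sign intervals, one at each double zero); it forces `#(κ-flips along J) ≤ 20 − 2|J|` (#54 `card_kappaFlips_le`).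

THE PROOF (`noBalance_of_rankOne`).  Test matrices (#53 `balance_pairing`): for every `β ∈ Sym₂ℝ`, `a^β_j = μ_jκ_j polar(β,P(τ_j))` is a kernel
vector of the exponential point evaluations, hence (#48) zero if supported on `≤ 6` abscissae and zero if its sign word is cut by `≤ 5` change points.
Let `k` be the LAST touch of `supp μ` (`|supp μ| ≥ 7`, #48 `seven_le_card_of_balance`).  (NO) If every touch of `supp μ` is `polar`-orthogonal —
i.e. parallel (#53 `exists_eq_smul_of_polar_eq_zero`) — to `P(τ_k)`: `≥ 7` parallel touches contradict #53 `false_of_parallel_touches` (`det P(τ_0) ≠ 0`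
as `0 ∉ J`).  (YES) Else let `l < k` be the last touch of `supp μ` NOT parallel to `P(τ_k)` and `X = β(P(τ_k), P(τ_l))` the Lorentz cross product (#53):
`polar(X, P(τ_k)) = polar(X, P(τ_l)) = 0`, and every touch of `supp μ` after `τ_l` is parallel to `P(τ_k)` (maximality of `l`), so `a^X` is supported on
touches BEFORE `τ_l`.  If `a^X = 0`, every touch of `supp μ` is orthogonal to `X`, hence (#53 `polar_eq_zero_or_of_cross`, the Gram identity) parallel
to `P(τ_k)` or to `P(τ_l)`; the test matrix `P(τ_l)` then gives a kernel vector supported EXACTLY on the touches parallel to `P(τ_k)` (`∋ k`), so there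
are `≥ 7` of them — `false_of_parallel_touches` again.  If `a^X ≠ 0` (`false_of_short_kernelVector`): `|supp a^X| ≥ 7`, so with `l, k` the support of `μ`
has `≥ 9` touches and `|J| ≥ 9`, so `κ` flips `≤ 2` times along `J` (#54); `g(t) = polar(X, P(t))` is a six-term sum (#53 `polar_expPencil`) vanishing at
`τ_l < τ_k`, so it flips `≤ 3` times along `supp a^X` (a fourth flip gives four ordered zeros below `τ_l` by #54 `exists_zeros_of_flips`, six in all, and
#53 `expCoeff_eq_zero_of_zeros` makes `g ≡ 0`); the sign word of `a^X_j = μ_j κ_j g(τ_j)` is therefore cut by the symmetric difference of the two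
flip-midpoint sets of #54 `signCut` — `≤ 5` change points — and #48 `eq_zero_of_expEval_combination_signWord` gives `a^X = 0`.  Contradiction in
every branch: NO BALANCE.  ★ `mem_twentyLocus_of_rankOne_touches` = #47 + `noBalance_of_rankOne`: every honestly encoded rank-one touch profile
has `δ ∈ TwentyLocus`.

READING for (R) (line lead's ledger; W2 does not write the line file): the typed proposal `SingleClusterDoubleZeroLift26` of the g18 memo §9 HOLDS with
the two encoding side conditions; the single-cluster part of (R)'s multiplicity residual is now: rank-ZERO double zeros (#46's second-order clause,
pointwise), zeros of order `3` (#49/#50, unconditional), order `≥ 4` (same ladder, not typed) — and NO balanced case.  The dimension count that made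
balanced profiles look 2-dimensional (g18 memo) is beaten by sign structure (`μ ≥ 0`, `κ` tied to the zero pattern) + the Chebyshev property.
Nothing here bears on `DoorA26`, `DoorA34`, (W)/(M)/(R) as typed, `MatrixDescartes` (18050) or `VP ≠ VNP`; registers `ζ_sym(2,6) ∈ {18,19,20}`,
`ζ_sym(3,4) ∈ {18,19}` UNCHANGED.

[folklore] Lorentzian linear algebra of `(Sym₂ℝ, det)`; discrete Chebyshev alternation for real exponentials (Gantmacher–Krein).  [this work] the
no-balance theorem and its packaging.
-/

set_option linter.dupNamespace false

namespace Summit.ValiantsHypothesis.ValiantsHypothesis.Theorems.LacunarySymmetroidMatrixDescartes.WallBubbling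

open Finset
open Bubbling (TwentyLocus polar polar_apply polar_comm polar_self)

/-- Product bookkeeping for two cut sets: `(∏_{W₁} h)(∏_{W₂} h) = (∏_{W₁ Δ W₂} h)·(∏_{W₁ ∩ W₂} h)²`. [folklore] -/
theorem prod_mul_prod_eq_symmDiff (W₁ W₂ : Finset ℝ) (h : ℝ → ℝ) :
    (∏ x ∈ W₁, h x) * (∏ x ∈ W₂, h x) =
      (∏ x ∈ (W₁ \ W₂) ∪ (W₂ \ W₁), h x) * (∏ x ∈ W₁ ∩ W₂, h x) ^ 2 := by
  classical
  have e1 : ∏ x ∈ W₁, h x = (∏ x ∈ W₁ \ W₂, h x) * ∏ x ∈ W₁ ∩ W₂, h x := by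
    rw [← Finset.prod_union (Finset.disjoint_sdiff_inter W₁ W₂), Finset.sdiff_union_inter]
  have e2 : ∏ x ∈ W₂, h x = (∏ x ∈ W₂ \ W₁, h x) * ∏ x ∈ W₁ ∩ W₂, h x := by
    rw [Finset.inter_comm W₁ W₂, ← Finset.prod_union (Finset.disjoint_sdiff_inter W₂ W₁), Finset.sdiff_union_inter]
  rw [e1, e2, Finset.prod_union disjoint_sdiff_sdiff]
  ring

/-- **THE SHORT KERNEL VECTOR IS IMPOSSIBLE** (the endgame of the no-balance theorem).  Honest encoding (`0, 20 ∉ J`, no two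
adjacent touch indices), `9 ≤ |J|`, weights `μ ≥ 0`, a test matrix `X` killing the pencil at two touches `τ_l < τ_k`, and the kernel
vector `a_j = μ_j κ_j polar(X, P(τ_j))` of the exponential point evaluations supported on touches BEFORE `τ_l` and not identically
zero: contradiction.  The sign word of `a` is cut by (≤ 2 flip midpoints of `κ` along `J`) Δ (≤ 3 flip midpoints of
`g = polar(X,P(·))` along the support — a fourth flip would give `g` six zeros), so `a = 0` by discrete Chebyshev alternation. [this work] -/
theorem false_of_short_kernelVector (δ : Fin 6 → ℝ) (hd : StrictMono δ) (S : Fin 6 → Matrix (Fin 2) (Fin 2) ℝ)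
    (τ : Fin 21 → ℝ) (hτ : StrictMono τ) (κ : Fin 21 → ℝ) (halt : ∀ j : Fin 20, κ j.castSucc * κ j.succ < 0)
    (J : Finset (Fin 21)) (h0 : (0 : Fin 21) ∉ J) (h20 : Fin.last 20 ∉ J)
    (hsep : ∀ j : Fin 20, j.castSucc ∈ J → j.succ ∉ J) (hJ9 : 9 ≤ J.card)
    (μ : Fin 21 → ℝ) (hμ0 : ∀ j, 0 ≤ μ j) (X : Matrix (Fin 2) (Fin 2) ℝ) (l k : Fin 21) (hlk : l < k)
    (hXl : polar X (∑ l', Real.exp (δ l' * τ l) • S l') = 0) (hXk : polar X (∑ l', Real.exp (δ l' * τ k) • S l') = 0)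
    (ha : ∀ m, ∑ j, (μ j * κ j * polar X (∑ l', Real.exp (δ l' * τ j) • S l')) * Real.exp (δ m * τ j) = 0)
    (hAJ : ∀ j, μ j * κ j * polar X (∑ l', Real.exp (δ l' * τ j) • S l') ≠ 0 → j ∈ J ∧ j < l)
    (hne : ∃ j, μ j * κ j * polar X (∑ l', Real.exp (δ l' * τ j) • S l') ≠ 0) : False := by
  classical
  set P : Fin 21 → Matrix (Fin 2) (Fin 2) ℝ := fun j => ∑ l', Real.exp (δ l' * τ j) • S l' with hP
  set a : Fin 21 → ℝ := fun j => μ j * κ j * polar X (P j) with haDef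
  -- the continuous six-term sum `g`
  set g : ℝ → ℝ := fun t => ∑ l', polar X (S l') * Real.exp (δ l' * t) with hg
  have hgP : ∀ j, polar X (P j) = g (τ j) := fun j => polar_expPencil δ S X (τ j)
  have hgc : Continuous g := by
    refine continuous_finsetSum _ fun l' _ => continuous_const.mul ?_
    exact Real.continuous_exp.comp (continuous_const.mul continuous_id)
  have hκ : ∀ j, κ j ≠ 0 := by
    intro j hz
    rcases Fin.eq_castSucc_or_eq_last j with ⟨m, hm⟩ | hlast
    · have := halt m; rw [← hm, hz, zero_mul] at this; exact lt_irrefl _ this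
    · have := halt (Fin.last 19); rw [Fin.succ_last, ← hlast, hz, mul_zero] at this; exact lt_irrefl _ this
  -- the support
  set A : Finset (Fin 21) := Finset.univ.filter fun j => a j ≠ 0 with hA
  have hAne : A.Nonempty := by
    obtain ⟨j, hj⟩ := hne; exact ⟨j, Finset.mem_filter.2 ⟨Finset.mem_univ _, hj⟩⟩
  have hmemA : ∀ j, j ∈ A ↔ a j ≠ 0 := fun j => by simp [hA]
  have hAJ' : ∀ j ∈ A, j ∈ J ∧ j < l := fun j hj => hAJ j ((hmemA j).1 hj)
  have hgA : ∀ j ∈ A, g (τ j) ≠ 0 := by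
    intro j hj hz; exact (hmemA j).1 hj (by show μ j * κ j * polar X (P j) = 0; rw [hgP, hz, mul_zero])
  have hμA : ∀ j ∈ A, 0 < μ j := by
    intro j hj
    refine lt_of_le_of_ne (hμ0 j) fun hz => (hmemA j).1 hj ?_
    show μ j * κ j * polar X (P j) = 0; rw [← hz]; ring
  -- enumerate `A` and `J`
  obtain ⟨kA, hkA⟩ : ∃ kA, A.card = kA + 1 := ⟨A.card - 1, by have := hAne.card_pos; omega⟩
  obtain ⟨kJ, hkJ⟩ : ∃ kJ, J.card = kJ + 1 := ⟨J.card - 1, by omega⟩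
  -- SIGN CUT 1: κ along J
  obtain ⟨hW₁card, hW₁avoid, hW₁cut⟩ := signCut τ hτ J hkJ κ (fun j _ => hκ j)
  set W₁ := (Finset.univ.filter fun i : Fin kJ =>
      κ (J.orderEmbOfFin hkJ i.castSucc) * κ (J.orderEmbOfFin hkJ i.succ) < 0).image
      (fun i : Fin kJ => (τ (J.orderEmbOfFin hkJ i.castSucc) + τ (J.orderEmbOfFin hkJ i.succ)) / 2) with hW₁
  have hW₁le : W₁.card ≤ 2 := by
    rw [hW₁card]
    have := card_kappaFlips_le J hkJ κ halt h0 h20 hsep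
    omega
  -- SIGN CUT 2: g along A
  obtain ⟨hW₂card, hW₂avoid, hW₂cut⟩ := signCut τ hτ A hkA (fun j => g (τ j)) hgA
  set F₂ := Finset.univ.filter fun i : Fin kA =>
      g (τ (A.orderEmbOfFin hkA i.castSucc)) * g (τ (A.orderEmbOfFin hkA i.succ)) < 0 with hF₂
  set W₂ := F₂.image (fun i : Fin kA => (τ (A.orderEmbOfFin hkA i.castSucc) + τ (A.orderEmbOfFin hkA i.succ)) / 2) with hW₂
  -- at most three flips of `g` along `A`: a fourth would give six zeros
  have hF₂le : F₂.card ≤ 3 := by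
    by_contra hlt
    have h4 : 4 ≤ F₂.card := by omega
    obtain ⟨z, hzmono, hzzero, hzlt⟩ := exists_zeros_of_flips τ hτ A hkA g hgc h4
    -- the largest element of `A` is below `τ_l`
    have hlast : τ (A.orderEmbOfFin hkA (Fin.last kA)) < τ l :=
      hτ (hAJ' _ (A.orderEmbOfFin_mem hkA _)).2
    let Z : Fin 6 → ℝ := ![z 0, z 1, z 2, z 3, τ l, τ k]
    have hZmono : StrictMono Z := by
      refine Fin.strictMono_iff_lt_succ.2 fun i => ?_
      fin_cases i
      · exact hzmono (by decide : (0 : Fin 4) < 1)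
      · exact hzmono (by decide : (1 : Fin 4) < 2)
      · exact hzmono (by decide : (2 : Fin 4) < 3)
      · exact (hzlt 3).trans hlast
      · exact hτ hlk
    have hZzero : ∀ m, ∑ l', polar X (S l') * Real.exp (δ l' * Z m) = 0 := by
      intro m
      fin_cases m
      · exact hzzero 0
      · exact hzzero 1
      · exact hzzero 2
      · exact hzzero 3
      · show g (τ l) = 0; rw [← hgP]; exact hXl
      · show g (τ k) = 0; rw [← hgP]; exact hXk
    have hcoef := expCoeff_eq_zero_of_zeros δ hd.injective Z hZmono.injective (fun l' => polar X (S l')) hZzero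
    obtain ⟨j, hj⟩ := hAne
    refine hgA j hj ?_
    show ∑ l', polar X (S l') * Real.exp (δ l' * τ j) = 0
    exact Finset.sum_eq_zero fun l' _ => by rw [congrFun hcoef l', Pi.zero_apply, zero_mul]
  have hW₂le : W₂.card ≤ 3 := hW₂card ▸ hF₂le
  -- the combined cut set
  set U : Finset ℝ := (W₁ \ W₂) ∪ (W₂ \ W₁) with hU
  have hUcard : U.card ≤ 5 := by
    calc U.card ≤ (W₁ \ W₂).card + (W₂ \ W₁).card := Finset.card_union_le _ _
      _ ≤ W₁.card + W₂.card := Nat.add_le_add (Finset.card_le_card Finset.sdiff_subset)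
          (Finset.card_le_card Finset.sdiff_subset)
      _ ≤ 5 := by omega
  have hUsub : U ⊆ W₁ ∪ W₂ := Finset.union_subset_union Finset.sdiff_subset Finset.sdiff_subset
  set q := U.card with hq
  have hq6 : q < 6 := by omega
  let u : Fin q ↪o ℝ := U.orderEmbOfFin rfl
  -- the constants of the two cuts
  set c₁ := κ (J.orderEmbOfFin hkJ 0) with hc₁
  set c₂ := g (τ (A.orderEmbOfFin hkA 0)) with hc₂
  have h1 : c₁ ≠ 0 := hκ _
  have h2 : c₂ ≠ 0 := hgA _ (A.orderEmbOfFin_mem hkA 0)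
  clear_value c₁ c₂
  -- discrete Chebyshev alternation kills `c₁ c₂ • a`
  have hzero := eq_zero_of_expEval_combination_signWord δ hd hq6 u u.strictMono τ A (fun j => c₁ * c₂ * a j)
    (fun j hj => by rw [show a j = 0 from not_not.1 (fun h => hj ((hmemA j).2 h))]; ring) ?_ ?_
  · obtain ⟨j, hj⟩ := hAne
    have h3 : a j ≠ 0 := (hmemA j).1 hj
    have := hzero j
    rcases mul_eq_zero.1 this with h | h
    · rcases mul_eq_zero.1 h with h' | h'
      · exact h1 h'
      · exact h2 h'
    · exact h3 h
  · -- the sign condition on `A`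
    intro j hj
    obtain ⟨hjJ, -⟩ := hAJ' j hj
    refine ⟨fun i => ?_, ?_⟩
    · have hi : u i ∈ W₁ ∪ W₂ := hUsub (U.orderEmbOfFin_mem rfl i)
      rcases Finset.mem_union.1 hi with hi | hi
      · exact (hW₁avoid j hjJ _ hi).symm
      · exact (hW₂avoid j hj _ hi).symm
    · have hX1 := hW₁cut j hjJ
      have hX2 := hW₂cut j hj
      have hμj := hμA j hj
      have hprod := mul_pos (mul_pos hX1 hX2) hμj
      have hre : c₁ * κ j * (∏ x ∈ W₁, (x - τ j)) * (c₂ * g (τ j) * ∏ x ∈ W₂, (x - τ j)) * μ j =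
          (c₁ * c₂ * (μ j * κ j * g (τ j)) * ∏ x ∈ U, (x - τ j)) * (∏ x ∈ W₁ ∩ W₂, (x - τ j)) ^ 2 := by
        have := prod_mul_prod_eq_symmDiff W₁ W₂ (fun x => x - τ j)
        rw [← hU] at this
        linear_combination (c₁ * κ j * c₂ * g (τ j) * μ j) * this
      rw [hre] at hprod
      have hsq : 0 < (∏ x ∈ W₁ ∩ W₂, (x - τ j)) ^ 2 := by
        have : (∏ x ∈ W₁ ∩ W₂, (x - τ j)) ≠ 0 := Finset.prod_ne_zero_iff.2 fun x hx =>
          sub_ne_zero.2 (hW₁avoid j hjJ x (Finset.mem_inter.1 hx).1)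
        positivity
      have := pos_of_mul_pos_left hprod hsq.le
      have haj : a j = μ j * κ j * g (τ j) := by
        show μ j * κ j * polar X (P j) = _; rw [hgP]
      show 0 ≤ c₁ * c₂ * a j * ∏ i, (u i - τ j)
      rw [haj, prod_orderEmbOfFin U rfl (fun x => x - τ j)]
      exact this.le
  · -- kernel vector
    intro m
    have hm : ∑ j, a j * Real.exp (δ m * τ j) = 0 := ha m
    calc ∑ j, c₁ * c₂ * a j * Real.exp (δ m * τ j) = (c₁ * c₂) * ∑ j, a j * Real.exp (δ m * τ j) := by
          rw [Finset.mul_sum Finset.univ (fun j => a j * Real.exp (δ m * τ j)) (c₁ * c₂)]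
          exact Finset.sum_congr rfl fun j _ => by ring
      _ = 0 := by rw [hm, mul_zero]

/-- **NO BALANCE (the rank-one multiplicity residual of (R) is empty).**  Strictly increasing exponents and abscissae, symmetric
letters, alternating virtual signs `κ`, an honestly encoded touch set `J` (`0, 20 ∉ J`, no two adjacent indices; off `J`
`0 < κ_j det P(τ_j)`, on `J` `det P(τ_j) = 0 ≠ tr P(τ_j)`).  Then NO BALANCE exists: the only `μ ≥ 0` supported on `J` with
`Σ_j μ_j κ_j e^{δ_l τ_j} P(τ_j) = 0` for all six `l` is `μ = 0`.  Proof: `k` = last touch of `supp μ`; if every touch of `supp μ` is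
parallel to `P(τ_k)` then `|supp μ| ≥ 7` parallel touches contradict `false_of_parallel_touches`; else `l` = last touch not parallel to
`P(τ_k)`, `X` = Lorentz cross product of `P(τ_k), P(τ_l)`; the kernel vector `μ_jκ_j polar(X,P(τ_j))` lives on touches before `τ_l`;
if it vanishes, every touch is parallel to `P(τ_k)` or `P(τ_l)` (Gram identity) and the `P(τ_l)`-test isolates `≥ 7` touches parallel
to `P(τ_k)`; if not, it has `≥ 7` entries, so `|J| ≥ 9`, and `false_of_short_kernelVector` ends it. [this work] -/
theorem noBalance_of_rankOne (δ : Fin 6 → ℝ) (hd : StrictMono δ) (S : Fin 6 → Matrix (Fin 2) (Fin 2) ℝ)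
    (hS : ∀ l, (S l).IsSymm) (τ : Fin 21 → ℝ) (hτ : StrictMono τ) (κ : Fin 21 → ℝ) (J : Finset (Fin 21))
    (hoff : ∀ j ∉ J, 0 < κ j * (∑ l, Real.exp (δ l * τ j) • S l).det)
    (hon : ∀ j ∈ J, (∑ l, Real.exp (δ l * τ j) • S l).det = 0 ∧ (∑ l, Real.exp (δ l * τ j) • S l).trace ≠ 0)
    (halt : ∀ j : Fin 20, κ j.castSucc * κ j.succ < 0)
    (h0 : (0 : Fin 21) ∉ J) (h20 : Fin.last 20 ∉ J) (hsep : ∀ j : Fin 20, j.castSucc ∈ J → j.succ ∉ J)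
    (μ : Fin 21 → ℝ) (hμ0 : ∀ j, 0 ≤ μ j) (hμJ : ∀ j ∉ J, μ j = 0)
    (hμ : ∀ l, ∑ j, (μ j * κ j * Real.exp (δ l * τ j)) • (∑ l', Real.exp (δ l' * τ j) • S l') = 0) :
    ∀ j, μ j = 0 := by
  classical
  set P : Fin 21 → Matrix (Fin 2) (Fin 2) ℝ := fun j => ∑ l', Real.exp (δ l' * τ j) • S l' with hP
  have hPsym : ∀ j, (P j) 1 0 = (P j) 0 1 := fun j => (isSymm_expPencil δ S hS (τ j)).apply 0 1
  have hκ : ∀ j, κ j ≠ 0 := by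
    intro j hz
    rcases Fin.eq_castSucc_or_eq_last j with ⟨m, hm⟩ | hlast
    · have := halt m; rw [← hm, hz, zero_mul] at this; exact lt_irrefl _ this
    · have := halt (Fin.last 19); rw [Fin.succ_last, ← hlast, hz, mul_zero] at this; exact lt_irrefl _ this
  have hdet0 : (P 0).det ≠ 0 := by
    intro hz; have := hoff 0 h0; rw [show (∑ l, Real.exp (δ l * τ 0) • S l).det = (P 0).det from rfl, hz,
      mul_zero] at this; exact lt_irrefl _ this
  -- kernel vectors from test matrices
  have hker : ∀ β : Matrix (Fin 2) (Fin 2) ℝ, ∀ m, ∑ j, (μ j * κ j * polar β (P j)) * Real.exp (δ m * τ j) = 0 :=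
    fun β m => balance_pairing δ S τ κ μ hμ β m
  by_contra hne
  push Not at hne
  -- the support `J'` of `μ`
  set J' : Finset (Fin 21) := Finset.univ.filter fun j => μ j ≠ 0 with hJ'
  have hmemJ' : ∀ j, j ∈ J' ↔ μ j ≠ 0 := fun j => by simp [hJ']
  have hJ'J : ∀ j ∈ J', j ∈ J := fun j hj => by
    by_contra h; exact (hmemJ' j).1 hj (hμJ j h)
  have hJ'ne : J'.Nonempty := by obtain ⟨j, hj⟩ := hne; exact ⟨j, (hmemJ' j).2 hj⟩
  have hμpos : ∀ j ∈ J', 0 < μ j := fun j hj => lt_of_le_of_ne (hμ0 j) (fun h => (hmemJ' j).1 hj h.symm)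
  -- `|J'| ≥ 7` (#48)
  have h7 : 7 ≤ J'.card :=
    seven_le_card_of_balance δ hd S τ hτ κ J' (fun j hj => ⟨hκ j, (hon j (hJ'J j hj)).2⟩) μ
      (fun j hj => not_not.1 fun h => hj ((hmemJ' j).2 h)) hne hμ
  -- the last touch of the support
  set k := J'.max' hJ'ne with hk
  have hkJ' : k ∈ J' := Finset.max'_mem _ _
  have hle_k : ∀ j ∈ J', j ≤ k := fun j hj => Finset.le_max' _ j hj
  obtain ⟨hkdet, hktr⟩ := hon k (hJ'J k hkJ')
  -- parallel touches are multiples (Lemma P)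
  have hpar : ∀ j ∈ J, polar (P k) (P j) = 0 → ∃ c : ℝ, P j = c • P k := fun j hj h =>
    exists_eq_smul_of_polar_eq_zero (P k) (P j) (hPsym k) (hPsym j) hkdet hktr (hon j hj).1 h
  set L : Finset (Fin 21) := J'.filter fun j => polar (P k) (P j) ≠ 0 with hL
  by_cases hLe : L = ∅
  · -- NO-case: every touch of the support is parallel to `P k`
    have hall : ∀ j ∈ J', ∃ c : ℝ, P j = c • P k := by
      intro j hj
      refine hpar j (hJ'J j hj) (not_not.1 fun h => ?_)
      have : j ∈ L := Finset.mem_filter.2 ⟨hj, h⟩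
      rw [hLe] at this; exact Finset.notMem_empty _ this
    exact false_of_parallel_touches δ hd S hS τ hτ 0 hdet0 (P k) (hPsym k) hkdet hktr J' (by omega) hall
  · -- YES-case
    have hLne : L.Nonempty := Finset.nonempty_iff_ne_empty.2 hLe
    set l := L.max' hLne with hl
    have hlL : l ∈ L := Finset.max'_mem _ _
    have hlJ' : l ∈ J' := (Finset.mem_filter.1 hlL).1
    have hkl : polar (P k) (P l) ≠ 0 := (Finset.mem_filter.1 hlL).2
    obtain ⟨hldet, hltr⟩ := hon l (hJ'J l hlJ')
    have hlk : l < k := by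
      refine lt_of_le_of_ne (hle_k l hlJ') fun h => hkl ?_
      rw [h, polar_self]; exact hkdet
    -- the cross product and its kernel vector
    set X : Matrix (Fin 2) (Fin 2) ℝ := !![2 * ((P k) 0 0 * (P l) 0 1 - (P k) 0 1 * (P l) 0 0),
        (P k) 0 0 * (P l) 1 1 - (P k) 1 1 * (P l) 0 0; (P k) 0 0 * (P l) 1 1 - (P k) 1 1 * (P l) 0 0,
        2 * ((P k) 0 1 * (P l) 1 1 - (P k) 1 1 * (P l) 0 1)] with hX
    obtain ⟨hXk, hXl⟩ := polar_cross_left_right (P k) (P l) (hPsym k) (hPsym l)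
    by_cases hzero : ∀ j, μ j * κ j * polar X (P j) = 0
    · -- every touch of the support is parallel to `P k` or to `P l`; the `P l`-test isolates those parallel to `P k`
      set A' : Finset (Fin 21) := J'.filter fun j => polar (P k) (P j) = 0 with hA'
      have hkA' : k ∈ A' := Finset.mem_filter.2 ⟨hkJ', by rw [polar_self]; exact hkdet⟩
      have hsuppl : ∀ j ∉ A', μ j * κ j * polar (P l) (P j) = 0 := by
        intro j hj
        by_cases hjJ' : j ∈ J'
        · have hXj : polar X (P j) = 0 := by
            have := hzero j
            rcases mul_eq_zero.1 this with h | h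
            · rcases mul_eq_zero.1 h with h' | h'
              · exact absurd h' ((hmemJ' j).1 hjJ')
              · exact absurd h' (hκ j)
            · exact h
          have hjk : polar (P k) (P j) ≠ 0 := fun h => hj (Finset.mem_filter.2 ⟨hjJ', h⟩)
          rcases polar_eq_zero_or_of_cross (P k) (P l) (P j) (hPsym k) (hPsym l) (hPsym j) hkdet hldet
            (hon j (hJ'J j hjJ')).1 hkl hXj with h | h
          · rw [h, mul_zero]
          · exact absurd (by rw [polar_comm]; exact h) hjk
        · rw [not_not.1 fun h => hjJ' ((hmemJ' j).2 h)]; ring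
      by_cases hA'card : A'.card ≤ 6
      · have hz := eq_zero_of_expEval_combination_eq_zero δ hd τ hτ A' hA'card
          (fun j => μ j * κ j * polar (P l) (P j)) hsuppl (hker (P l)) k
        rcases mul_eq_zero.1 hz with h | h
        · rcases mul_eq_zero.1 h with h' | h'
          · exact (hmemJ' k).1 hkJ' h'
          · exact hκ k h'
        · exact hkl (by rw [polar_comm]; exact h)
      · refine false_of_parallel_touches δ hd S hS τ hτ 0 hdet0 (P k) (hPsym k) hkdet hktr A' (by omega) ?_
        intro j hj
        obtain ⟨hjJ', hjk⟩ := Finset.mem_filter.1 hj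
        exact hpar j (hJ'J j hjJ') hjk
    · -- the short kernel vector
      push Not at hzero
      refine false_of_short_kernelVector δ hd S τ hτ κ halt J h0 h20 hsep ?_ μ hμ0 X l k hlk hXl hXk (hker X) ?_ hzero
      · -- `|J| ≥ 9`: the support of the kernel vector, `l` and `k` are nine distinct touches
        set A : Finset (Fin 21) := Finset.univ.filter fun j => μ j * κ j * polar X (P j) ≠ 0 with hA
        have hAsub : ∀ j ∈ A, j ∈ J' ∧ j ≠ l ∧ j ≠ k := by
          intro j hj
          have hj' := (Finset.mem_filter.1 hj).2
          refine ⟨(hmemJ' j).2 fun h => hj' (by rw [h]; ring), fun h => hj' ?_, fun h => hj' ?_⟩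
          · rw [h, hXl, mul_zero]
          · rw [h, hXk, mul_zero]
        have hA7 : 7 ≤ A.card := by
          by_contra hlt
          obtain ⟨j, hj⟩ := hzero
          have := eq_zero_of_expEval_combination_eq_zero δ hd τ hτ A (by omega)
            (fun j => μ j * κ j * polar X (P j)) (fun j hj => not_not.1 fun h =>
              hj (Finset.mem_filter.2 ⟨Finset.mem_univ _, h⟩)) (hker X) j
          exact hj this
        have hsub : insert l (insert k A) ⊆ J := by
          intro j hj
          rcases Finset.mem_insert.1 hj with rfl | hj
          · exact hJ'J _ hlJ'
          rcases Finset.mem_insert.1 hj with rfl | hj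
          · exact hJ'J _ hkJ'
          · exact hJ'J _ (hAsub j hj).1
        have hcard : (insert l (insert k A)).card = A.card + 2 := by
          rw [Finset.card_insert_of_notMem, Finset.card_insert_of_notMem]
          · exact fun h => (hAsub k h).2.2 rfl
          · rw [Finset.mem_insert, not_or]
            exact ⟨ne_of_lt hlk, fun h => (hAsub l h).2.1 rfl⟩
        have := Finset.card_le_card hsub
        omega
      · -- the support lies before `l`
        intro j hj
        change μ j * κ j * polar X (P j) ≠ 0 at hj
        have hjJ' : j ∈ J' := (hmemJ' j).2 fun h => hj (by rw [h]; ring)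
        refine ⟨hJ'J j hjJ', ?_⟩
        by_contra hjl
        rcases lt_or_eq_of_le (not_lt.1 hjl) with hlt | heq
        · -- `l < j ≤ k`
          rcases lt_or_eq_of_le (hle_k j hjJ') with hjk | hjk
          · -- `j ∉ L` by maximality of `l`, so `P j ∥ P k`, so `polar X (P j) = 0`
            have hjL : j ∉ L := fun h => not_le.2 hlt (by rw [hl]; exact Finset.le_max' L j h)
            have hpk : polar (P k) (P j) = 0 := not_not.1 fun h => hjL (Finset.mem_filter.2 ⟨hjJ', h⟩)
            obtain ⟨c, hc⟩ := hpar j (hJ'J j hjJ') hpk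
            exact hj (by rw [hc, polar_smul_right, hXk]; ring)
          · exact hj (by rw [hjk, hXk, mul_zero])
        · exact hj (by rw [← heq, hXl, mul_zero])

/-- **EVERY HONESTLY ENCODED RANK-ONE TOUCH PROFILE LIFTS.**  Strictly increasing exponents `δ` and abscissae `τ`, symmetric
letters, alternating virtual signs `κ`, a touch set `J` with `0, 20 ∉ J` and no two adjacent indices (the encoding of a limit profile
with `n` rank-one double zeros and `20 − 2n` simple zeros on `21` abscissae: one abscissa in each constant-sign interval, one at each
double zero); off `J` the signs `0 < κ_j det P(τ_j)`, on `J` `det P(τ_j) = 0 ≠ tr P(τ_j)`.  Then `δ ∈ TwentyLocus` — by #47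
`mem_twentyLocus_of_touches_noBalance` and `noBalance_of_rankOne`.  This is the single-cluster RANK-ONE multiplicity residual
of obligation (R) of the `wall_bubbling` line, now unconditional. [this work] -/
theorem mem_twentyLocus_of_rankOne_touches (δ : Fin 6 → ℝ) (hd : StrictMono δ) (S : Fin 6 → Matrix (Fin 2) (Fin 2) ℝ)
    (hS : ∀ l, (S l).IsSymm) (τ : Fin 21 → ℝ) (hτ : StrictMono τ) (κ : Fin 21 → ℝ) (J : Finset (Fin 21))
    (hoff : ∀ j ∉ J, 0 < κ j * (∑ l, Real.exp (δ l * τ j) • S l).det)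
    (hon : ∀ j ∈ J, (∑ l, Real.exp (δ l * τ j) • S l).det = 0 ∧ (∑ l, Real.exp (δ l * τ j) • S l).trace ≠ 0)
    (halt : ∀ j : Fin 20, κ j.castSucc * κ j.succ < 0)
    (h0 : (0 : Fin 21) ∉ J) (h20 : Fin.last 20 ∉ J) (hsep : ∀ j : Fin 20, j.castSucc ∈ J → j.succ ∉ J) :
    δ ∈ TwentyLocus :=
  mem_twentyLocus_of_touches_noBalance δ S hS τ hτ κ J hoff (fun j hj => (hon j hj).1)
    (fun μ hμ0 hμJ hμ => noBalance_of_rankOne δ hd S hS τ hτ κ J hoff hon halt h0 h20 hsep μ hμ0 hμJ hμ) halt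

end Summit.ValiantsHypothesis.ValiantsHypothesis.Theorems.LacunarySymmetroidMatrixDescartes.WallBubbling
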